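import Summits.CriticalPhenomena.CardyFormulaZ2.Theorems.CardyUSTContinuationKirchhoffExtremalLengthMinimal

/-!
# Kirchhoff's theorem for the UST limit of the jointly wired FK model, II: roots and traversed
# edges of a crossing configuration

Support file for `KirchhoffExtremalLength` (route CardyUSTContinuation of `CardyFormulaZ2`, item
stmt-CriticalPhenomena-11234); part of the proof of Kirchhoff's theorem for the uniform-spanning-tree
limit of the jointly wired FK model (`coeff_div_coeff_eq_toReal_effectiveConductance`, part V).
This part: in a crossing configuration of exponent `m + 1` every vertex has at most one root in
`B₁` and at most one in `B₂` (`root_unique_of_succ`), and at each vertex at most one traversed edge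
leaves and at most one enters (`traversed_out_unique`, `traversed_in_unique`).
-/

noncomputable section

namespace Summit.CriticalPhenomena.CardyFormulaZ2.Theorems

namespace KirchhoffSlope

open Finset SimpleGraph
open Literature.Probability.LatticeModels Literature.Probability.Percolation

variable {V : Type*} [DecidableEq V]

/-! ### §4. Crossing configurations of exponent `m + 1` -/

section NextToMinimal

variable [Fintype V] {G : SimpleGraph V} [DecidableRel G.Adj] {W : Set V} {m : ℕ}

/-- **Unique roots in a crossing configuration of exponent `m + 1`.** Let `B₁, B₂ ⊆ W` be
disjoint and let `ω'` have exponent `m + 1` and an open crossing from `B₁` to `B₂`. Then every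
vertex reaches at most one vertex of `B₁` by open paths. (If `x` reached `a₁ ≠ a₂`, removing the
first edge of the open path `a₁ → a₂` would keep the wired cluster count, producing a minimiser
which still contains an open crossing — `reachable_erase_trichotomy` — contradicting
`not_reachable_of_minimal`.) For the roots in `B₂` apply the lemma with `B₁`, `B₂` exchanged.
[folklore] -/
theorem root_unique_of_succ
    (hm : ∀ ω ⊆ G.edgeFinset, m ≤ #ω + 2 * clusterCount (↑ω : BondConfig V) W)
    {ω' : Finset (Sym2 V)} (hω' : ω' ⊆ G.edgeFinset)
    (hE' : #ω' + 2 * clusterCount (↑ω' : BondConfig V) W = m + 1)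
    {B₁ B₂ : Set V} (hB₁ : B₁ ⊆ W) (hB₂ : B₂ ⊆ W) (hdisj : Disjoint B₁ B₂)
    (hcross : ∃ a ∈ B₁, ∃ b ∈ B₂, (openGraph (↑ω' : BondConfig V)).Reachable a b)
    {x a₁ a₂ : V} (ha₁ : a₁ ∈ B₁) (ha₂ : a₂ ∈ B₁) (h₁ : (openGraph (↑ω' : BondConfig V)).Reachable x a₁)
    (h₂ : (openGraph (↑ω' : BondConfig V)).Reachable x a₂) : a₁ = a₂ := by
  classical
  by_contra hne
  obtain ⟨p, hp⟩ : ∃ p : (openGraph (↑ω' : BondConfig V)).Walk a₁ a₂, p.IsPath :=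
    ⟨(h₁.symm.trans h₂).some.toPath, (h₁.symm.trans h₂).some.toPath.2⟩
  cases p with
  | nil => exact hne rfl
  | @cons _ y _ hay p' =>
    obtain ⟨hmem, hne'⟩ := (openGraph_adj _ _ _).1 hay
    rw [SimpleGraph.Walk.cons_isPath_iff] at hp
    set ω'' := ω'.erase s(a₁, y) with hω''
    have hy : (openGraph (↑ω'' : BondConfig V)).Reachable y a₂ :=
      reachable_erase_of_notMem_support p' hp.2
    have hH : (openGraph (↑ω'' : BondConfig V) ⊔ wired W).Reachable a₁ y :=
      ((reachable_wired (hB₁ ha₁) (hB₁ ha₂)).mono le_sup_right).trans (hy.symm.mono le_sup_left)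
    have hk : clusterCount (↑ω'' : BondConfig V) W = clusterCount (↑ω' : BondConfig V) W :=
      clusterCount_erase_eq_of_reachable hH
    have hsub : ω'' ⊆ G.edgeFinset := (Finset.erase_subset _ _).trans hω'
    have hEe : #ω'' + 2 * clusterCount (↑ω'' : BondConfig V) W = m := by
      rw [hk, hω'', Finset.card_erase_of_mem hmem]
      have hpos : 0 < #ω' := Finset.card_pos.2 ⟨_, hmem⟩
      omega
    -- the minimiser `ω''` still has an open crossing between distinct wired vertices
    obtain ⟨a, ha, b, hb, hab⟩ := hcross
    have key : ∀ {a' b' : V}, a' ∈ W → b' ∈ B₂ → (openGraph (↑ω'' : BondConfig V)).Reachable a' b' →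
        a' ∉ B₂ → False := fun {a' b'} ha' hb' hr hnot =>
      not_reachable_of_minimal hm hsub hEe ha' (hB₂ hb') (fun h => hnot (h ▸ hb')) hr
    have haB₂ : a ∉ B₂ := fun h => hdisj.ne_of_mem ha h rfl
    have ha₁B₂ : a₁ ∉ B₂ := fun h => hdisj.ne_of_mem ha₁ h rfl
    have ha₂B₂ : a₂ ∉ B₂ := fun h => hdisj.ne_of_mem ha₂ h rfl
    rcases reachable_erase_trichotomy (u := a₁) (v := y) hab.some with h | ⟨-, h⟩ | ⟨-, h⟩
    · exact key (hB₁ ha) hb h haB₂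
    · exact key (hB₁ ha₂) hb (hy.symm.trans h) ha₂B₂
    · exact key (hB₁ ha₁) hb h ha₁B₂

end NextToMinimal


/-! ### §5. Traversed edges of a crossing configuration: uniqueness and existence -/

section Traversal

variable [Fintype V] {G : SimpleGraph V} [DecidableRel G.Adj] {W : Set V} {m : ℕ}
  {B₁ B₂ : Set V} {ω' : Finset (Sym2 V)}

/-- In a minimiser, a neighbour (in `G`) of a vertex rooted in `B₁` which is not itself rooted in
`B₁` is rooted in `B₂`. [folklore] -/
theorem exists_root_mem_of_not
    (hm : ∀ ω ⊆ G.edgeFinset, m ≤ #ω + 2 * clusterCount (↑ω : BondConfig V) W)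
    (hB₁ : B₁ ⊆ W) (hW : W ⊆ B₁ ∪ B₂)
    {ω : Finset (Sym2 V)} (hω : ω ⊆ G.edgeFinset) (hE : #ω + 2 * clusterCount (↑ω : BondConfig V) W = m)
    {z w a : V} (ha : a ∈ B₁) (hza : (openGraph (↑ω : BondConfig V)).Reachable z a) (hzw : G.Adj z w)
    (hn : ¬ ∃ a' ∈ B₁, (openGraph (↑ω : BondConfig V)).Reachable w a') :
    ∃ b ∈ B₂, (openGraph (↑ω : BondConfig V)).Reachable w b := by
  obtain ⟨u, hu, hwu⟩ := exists_root_of_minimal hm hω hE (hB₁ ha)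
    (hzw.symm.reachable.trans (hza.mono (openGraph_le_of_subset hω)))
  rcases hW hu with h | h
  · exact (hn ⟨u, h, hwu⟩).elim
  · exact ⟨u, h, hwu⟩

omit [DecidableEq V] [Fintype V] in
/-- Two different edges at the same vertex. [folklore] -/
theorem sym2_ne_of_ne {z w₁ w₂ : V} (hne : w₁ ≠ w₂) (hz : z ≠ w₁) : s(z, w₂) ≠ s(z, w₁) := by
  intro heq
  rw [Sym2.eq_iff] at heq
  rcases heq with ⟨-, h⟩ | ⟨h, -⟩
  · exact hne h.symm
  · exact hz h

/-- **At most one traversed edge leaves a vertex.** In a crossing configuration `ω'` of exponent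
`m + 1` (disjoint `B₁, B₂` with `W = B₁ ∪ B₂`), call the edge `zw ∈ ω'` *traversed from `z` to
`w`* if `ω' ∖ zw` is a minimiser in which `z` is rooted in `B₁` and `w` is not. For each `z` there
is at most one such `w`. [folklore] -/
theorem traversed_out_unique
    (hm : ∀ ω ⊆ G.edgeFinset, m ≤ #ω + 2 * clusterCount (↑ω : BondConfig V) W)
    (hω' : ω' ⊆ G.edgeFinset) (hE' : #ω' + 2 * clusterCount (↑ω' : BondConfig V) W = m + 1)
    (hB₁ : B₁ ⊆ W) (hB₂ : B₂ ⊆ W) (hW : W ⊆ B₁ ∪ B₂) (hdisj : Disjoint B₁ B₂)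
    (hcross : ∃ a ∈ B₁, ∃ b ∈ B₂, (openGraph (↑ω' : BondConfig V)).Reachable a b)
    {z w₁ w₂ : V}
    (h₁ : s(z, w₁) ∈ ω')
    (hE₁ : #(ω'.erase s(z, w₁)) + 2 * clusterCount (↑(ω'.erase s(z, w₁)) : BondConfig V) W = m)
    (hc₁ : ∃ a ∈ B₁, (openGraph (↑(ω'.erase s(z, w₁)) : BondConfig V)).Reachable z a)
    (hn₁ : ¬ ∃ a ∈ B₁, (openGraph (↑(ω'.erase s(z, w₁)) : BondConfig V)).Reachable w₁ a)
    (h₂ : s(z, w₂) ∈ ω')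
    (hE₂ : #(ω'.erase s(z, w₂)) + 2 * clusterCount (↑(ω'.erase s(z, w₂)) : BondConfig V) W = m)
    (hc₂ : ∃ a ∈ B₁, (openGraph (↑(ω'.erase s(z, w₂)) : BondConfig V)).Reachable z a)
    (hn₂ : ¬ ∃ a ∈ B₁, (openGraph (↑(ω'.erase s(z, w₂)) : BondConfig V)).Reachable w₂ a) :
    w₁ = w₂ := by
  classical
  by_contra hne
  set ω₁ := ω'.erase s(z, w₁) with hω₁
  set ω₂ := ω'.erase s(z, w₂) with hω₂
  have hsub₁ : ω₁ ⊆ G.edgeFinset := (Finset.erase_subset _ _).trans hω'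
  have hsub₂ : ω₂ ⊆ G.edgeFinset := (Finset.erase_subset _ _).trans hω'
  have hzw₁ : G.Adj z w₁ := mem_edgeFinset.1 (hω' h₁)
  have hzw₂ : G.Adj z w₂ := mem_edgeFinset.1 (hω' h₂)
  obtain ⟨a₁, ha₁, hza₁⟩ := hc₁
  obtain ⟨a₂, ha₂, hza₂⟩ := hc₂
  obtain ⟨b₁, hb₁, hw₁b₁⟩ := exists_root_mem_of_not hm hB₁ hW hsub₁ hE₁ ha₁ hza₁ hzw₁ hn₁
  obtain ⟨b₂, hb₂, hw₂b₂⟩ := exists_root_mem_of_not hm hB₁ hW hsub₂ hE₂ ha₂ hza₂ hzw₂ hn₂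
  -- in `ω'`, `z` reaches `b₁` and `b₂`, hence `b₁ = b₂`
  have mono₁ : openGraph (↑ω₁ : BondConfig V) ≤ openGraph (↑ω' : BondConfig V) :=
    openGraph_mono (Finset.coe_subset.2 (Finset.erase_subset _ _))
  have mono₂ : openGraph (↑ω₂ : BondConfig V) ≤ openGraph (↑ω' : BondConfig V) :=
    openGraph_mono (Finset.coe_subset.2 (Finset.erase_subset _ _))
  have adj₁ : (openGraph (↑ω' : BondConfig V)).Adj z w₁ := (openGraph_adj _ _ _).2 ⟨h₁, hzw₁.ne⟩
  have adj₂ : (openGraph (↑ω' : BondConfig V)).Adj z w₂ := (openGraph_adj _ _ _).2 ⟨h₂, hzw₂.ne⟩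
  obtain ⟨a, ha, b, hb, hab⟩ := hcross
  have hbb : b₁ = b₂ :=
    root_unique_of_succ hm hω' hE' hB₂ hB₁ hdisj.symm ⟨b, hb, a, ha, hab.symm⟩ hb₁ hb₂
      (adj₁.reachable.trans (hw₁b₁.mono mono₁)) (adj₂.reachable.trans (hw₂b₂.mono mono₂))
  subst hbb
  -- contradiction inside the minimiser `ω₁`
  have hmem₂₁ : s(z, w₂) ∈ ω₁ := Finset.mem_erase.2 ⟨sym2_ne_of_ne hne hzw₁.ne, h₂⟩
  have adj₂₁ : (openGraph (↑ω₁ : BondConfig V)).Adj z w₂ := (openGraph_adj _ _ _).2 ⟨hmem₂₁, hzw₂.ne⟩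
  have ha₁b : a₁ ≠ b₁ := hdisj.ne_of_mem ha₁ hb₁
  have contra : (openGraph (↑ω₁ : BondConfig V)).Reachable z b₁ → False := fun h =>
    not_reachable_of_minimal hm hsub₁ hE₁ (hB₁ ha₁) (hB₂ hb₁) ha₁b (hza₁.symm.trans h)
  have hcomm : ω₂.erase s(z, w₁) = ω₁.erase s(z, w₂) := Finset.erase_right_comm
  have mono₁₂ : openGraph (↑(ω₁.erase s(z, w₂)) : BondConfig V) ≤ openGraph (↑ω₁ : BondConfig V) :=
    openGraph_mono (Finset.coe_subset.2 (Finset.erase_subset _ _))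
  rcases reachable_erase_trichotomy (ω := ω₂) (u := z) (v := w₁) hw₂b₂.some with h | ⟨h, -⟩ | ⟨-, h⟩
  · rw [hcomm] at h
    exact contra (adj₂₁.reachable.trans (h.mono mono₁₂))
  · rw [hcomm] at h
    exact not_reachable_erase_of_minimal hm hsub₁ hE₁ hmem₂₁ (h.symm.mono le_sup_left)
  · rw [hcomm] at h
    exact contra (h.mono mono₁₂)

/-- **At most one traversed edge enters a vertex.** With the terminology of
`traversed_out_unique`: for each `z` there is at most one `w` such that `wz` is traversed from
`w` to `z`. [folklore] -/
theorem traversed_in_unique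
    (hm : ∀ ω ⊆ G.edgeFinset, m ≤ #ω + 2 * clusterCount (↑ω : BondConfig V) W)
    (hω' : ω' ⊆ G.edgeFinset) (hE' : #ω' + 2 * clusterCount (↑ω' : BondConfig V) W = m + 1)
    (hB₁ : B₁ ⊆ W) (hB₂ : B₂ ⊆ W) (hW : W ⊆ B₁ ∪ B₂) (hdisj : Disjoint B₁ B₂)
    (hcross : ∃ a ∈ B₁, ∃ b ∈ B₂, (openGraph (↑ω' : BondConfig V)).Reachable a b)
    {z w₁ w₂ : V}
    (h₁ : s(w₁, z) ∈ ω')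
    (hE₁ : #(ω'.erase s(w₁, z)) + 2 * clusterCount (↑(ω'.erase s(w₁, z)) : BondConfig V) W = m)
    (hc₁ : ∃ a ∈ B₁, (openGraph (↑(ω'.erase s(w₁, z)) : BondConfig V)).Reachable w₁ a)
    (hn₁ : ¬ ∃ a ∈ B₁, (openGraph (↑(ω'.erase s(w₁, z)) : BondConfig V)).Reachable z a)
    (h₂ : s(w₂, z) ∈ ω')
    (hc₂ : ∃ a ∈ B₁, (openGraph (↑(ω'.erase s(w₂, z)) : BondConfig V)).Reachable w₂ a) :
    w₁ = w₂ := by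
  classical
  by_contra hne
  set ω₁ := ω'.erase s(w₁, z) with hω₁
  set ω₂ := ω'.erase s(w₂, z) with hω₂
  have hsub₁ : ω₁ ⊆ G.edgeFinset := (Finset.erase_subset _ _).trans hω'
  have hsub₂ : ω₂ ⊆ G.edgeFinset := (Finset.erase_subset _ _).trans hω'
  have hzw₁ : G.Adj w₁ z := mem_edgeFinset.1 (hω' h₁)
  have hzw₂ : G.Adj w₂ z := mem_edgeFinset.1 (hω' h₂)
  obtain ⟨a₁, ha₁, hwa₁⟩ := hc₁
  obtain ⟨a₂, ha₂, hwa₂⟩ := hc₂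
  -- the roots of `z` in `ω₁`, `ω₂` lie in `B₂`
  obtain ⟨b₁, hb₁, hzb₁⟩ := exists_root_mem_of_not hm hB₁ hW hsub₁ hE₁ ha₁ hwa₁ hzw₁ hn₁
  -- in `ω'`, `z` reaches `a₁` and `a₂`, hence `a₁ = a₂`
  have mono₁ : openGraph (↑ω₁ : BondConfig V) ≤ openGraph (↑ω' : BondConfig V) :=
    openGraph_mono (Finset.coe_subset.2 (Finset.erase_subset _ _))
  have mono₂ : openGraph (↑ω₂ : BondConfig V) ≤ openGraph (↑ω' : BondConfig V) :=
    openGraph_mono (Finset.coe_subset.2 (Finset.erase_subset _ _))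
  have adj₁ : (openGraph (↑ω' : BondConfig V)).Adj w₁ z := (openGraph_adj _ _ _).2 ⟨h₁, hzw₁.ne⟩
  have adj₂ : (openGraph (↑ω' : BondConfig V)).Adj w₂ z := (openGraph_adj _ _ _).2 ⟨h₂, hzw₂.ne⟩
  have haa : a₁ = a₂ :=
    root_unique_of_succ hm hω' hE' hB₁ hB₂ hdisj hcross ha₁ ha₂
      (adj₁.symm.reachable.trans (hwa₁.mono mono₁)) (adj₂.symm.reachable.trans (hwa₂.mono mono₂))
  subst haa
  -- contradiction inside the minimiser `ω₁`
  have hmem₂₁ : s(w₂, z) ∈ ω₁ := by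
    refine Finset.mem_erase.2 ⟨fun heq => ?_, h₂⟩
    rw [Sym2.eq_iff] at heq
    rcases heq with ⟨h, -⟩ | ⟨h, -⟩
    · exact hne h.symm
    · exact hzw₂.ne h
  have adj₂₁ : (openGraph (↑ω₁ : BondConfig V)).Adj w₂ z := (openGraph_adj _ _ _).2 ⟨hmem₂₁, hzw₂.ne⟩
  have ha₁b : a₁ ≠ b₁ := hdisj.ne_of_mem ha₁ hb₁
  have contra : (openGraph (↑ω₁ : BondConfig V)).Reachable z a₁ → False := fun h =>
    not_reachable_of_minimal hm hsub₁ hE₁ (hB₁ ha₁) (hB₂ hb₁) ha₁b (h.symm.trans hzb₁)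
  have hcomm : ω₂.erase s(w₁, z) = ω₁.erase s(w₂, z) := Finset.erase_right_comm
  have mono₁₂ : openGraph (↑(ω₁.erase s(w₂, z)) : BondConfig V) ≤ openGraph (↑ω₁ : BondConfig V) :=
    openGraph_mono (Finset.coe_subset.2 (Finset.erase_subset _ _))
  rcases reachable_erase_trichotomy (ω := ω₂) (u := w₁) (v := z) hwa₂.some with h | ⟨-, h⟩ | ⟨h, -⟩
  · rw [hcomm] at h
    exact contra (adj₂₁.symm.reachable.trans (h.mono mono₁₂))
  · rw [hcomm] at h
    exact contra (h.mono mono₁₂)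
  · rw [hcomm] at h
    exact not_reachable_erase_of_minimal hm hsub₁ hE₁ hmem₂₁ (h.mono le_sup_left)

end Traversal

end KirchhoffSlope

end Summit.CriticalPhenomena.CardyFormulaZ2.Theorems
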